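import Literature.AlgebraicGeometry.ModuliOfAbelianVarieties.SiegelFamilyRealLocusClosed
import HarnessLib

/-!
# `τ(Z) = −Z̄` descends to `X = Γ∖𝔥_g`: for every `τ`-stable subgroup `Γ ⊂ Sp_{2g}(ℝ)` there is a continuous
# involution `τ_X` of the quotient with `τ_X[Ω] = [τΩ]`, whose fixed set `X_ℝ` has preimage the real locus
# `S = ℍ_g^{τΓ} = {Ω : ∃ γ ∈ Γ, γ • Ω = τΩ}`, and which is closed when `Γ` is discrete (`Γ_g`, `Γ_g(q)`)
# (Goresky–Tai 2003, §2.3, §4.2; Yang 2015, §2; Lange 2023, Thm. 3.1.11)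

Topic `Literature/AlgebraicGeometry/ModuliOfAbelianVarieties` (the Siegel-family files, namespace
`Literature.AlgebraicGeometry.ModuliOfAbelianVarieties.SiegelModuli`).  Lane `lit-hodgefound` (Track 2
foundations library), prover seat p15 generation 51, row g51-#8, on top of g51-#7 `SiegelFamilyRealLocusClosed`
(`τ` continuous, the real locus is closed), g51-#4/#5 (`τ(Γ_g(q)) = Γ_g(q)`: `conjK_mul_mul_conjK_mem_siegelPrincipalGamma`,
`symplecticIntHom_conjK`), g50-#7 (`τ(x • Ω) = τ(x) • τΩ`, `τ(Γ_g) = Γ_g`) and the tree's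
`SiegelUpperHalfSpaceProperAction` (`Γ∖𝔥_g` is Hausdorff for discrete `Γ`; subgroups with integer entries are
discrete).  THEOREMS ONLY: no definition (the descended map is delivered by an existence statement together
with all the properties used downstream), no instance, no notation, no named fact (net Literature debt `0`),
no `sorry`.

## Sources, VERBATIM

* M. Goresky, Y. S. Tai, Compositio Math. **139** (2003) = arXiv:math/0108103, held `paper:arxiv-math_0108103`,
  §2.3 p0004: «Let `Γ ⊂ Sp(2n, ℤ)` be a torsion-free arithmetic subgroup such that `τ(Γ) = Γ` and let
  `X = Γ∖𝔥_n`.  Then `τ` passes to an anti-holomorphic involution on `X` and we denote by `X_ℝ` the set of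
  real points (i.e. the points fixed by the involution `τ`).»; §4.2 p0007: «Let `X = Γ(N)∖𝔥_n`. … The involution
  `τ(Z) = −Z̄` passes to an anti-holomorphic involution on `X` and defines a real structure (let us call it
  the `τ`-real structure) on `X`.  In this section we will determine the real points of `X`. … Define
  `S = ⋃_{γ ∈ Γ(4m)} 𝔥_n^γ ⊂ 𝔥_n` to be the set of all `Γ(4m)`-real points in `𝔥_n`.  Denote by `Γ(4m)∖S` the
  image of `S` in `X = Γ(4m)∖𝔥_n`. … the image `[Z] ∈ X` of a point `Z ∈ 𝔥_n` lies in `X_ℝ` iff there exists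
  `γ ∈ Γ(4m)` such that `γZ = −Z̄` (i.e. such that `Z ∈ 𝔥_n^γ`)»; «**Theorem 8.** The set `X_ℝ` of real points
  of `X` is precisely `Γ(4m)∖S`.»
* J.-H. Yang, J. Korean Math. Soc. **52** (2015) = arXiv:0912.5084, held `paper:arxiv-0912.5084`, §2 p0004:
  «`τ(x·Ω) = τ(x)τ(Ω)` for all `x ∈ Sp(g, ℝ)`, `Ω ∈ ℍ_g` … the involution `τ : ℍ_g → ℍ_g` is the
  antiholomorphic involution given by `τ(Ω) = −Ω̄`»; p0005: «If `Γ ⊂ Sp(g, ℝ)` is an arithmetic subgroup of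
  `Sp(g, ℝ)` such that `τ(Γ) = Γ`, we define `ℍ_g^{τΓ} := ⋃_{γ ∈ Γ} ℍ_g^{τγ}`».
* H. Lange (2023), §3.1.4 Thm. 3.1.11 (held p0162): the quotient of `𝔥_g` by a group acting properly and
  discontinuously is a (Hausdorff) normal complex analytic space.

## What is proved (`τΩ = −Ω̄`, `τ(x) = I_* x I_*`, `X = Quotient (MulAction.orbitRel Γ 𝔥_g)`, `π = Quotient.mk`)

* §1 `negConj_negConj_siegelUpperHalfSpace` (`τ² = id` on `𝔥_g`), **`quotientMk_negConj_eq_quotientMk_iff`** (THE OBSERVATION: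
  `π(τΩ) = π(Ω) ⟺ ∃ γ ∈ Γ, γ • Ω = τΩ`, every subgroup `Γ`).
* §2 **`exists_continuous_involutive_quotientMap_negConj`** — for every `τ`-stable subgroup `Γ ⊂ Sp_{2g}(ℝ)`
  there is `τ_X : X → X` continuous and involutive with `τ_X ∘ π = π ∘ τ`, `τ_X π(Ω) = π(Ω) ⟺ ∃ γ ∈ Γ, γ • Ω = τΩ`,
  and `π⁻¹(Fix τ_X) = S = {Ω : ∃ γ ∈ Γ, γ • Ω = τΩ}` («`τ` passes to an … involution on `X`», «`[Z] ∈ X_ℝ` iff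
  … `γZ = −Z̄`»); `isClosed_setOf_apply_eq_self_of_discrete` (for discrete `Γ` the fixed set of any continuous
  self-map of `X` is closed — `X` is Hausdorff).
* §3 THE TWO CASES OF THE SOURCES: **`exists_quotientMap_negConj_siegelModularGroup`** (`Γ = Γ_g = Sp_{2g}(ℤ)`;
  `X_ℝ` closed, `π⁻¹(X_ℝ) = ℍ_g^{τΓ_g}`, itself closed by g51-#7) and, for the principal congruence subgroups,
  `mem_map_siegelPrincipalGamma_iff`, `iStarConj_mem_map_siegelPrincipalGamma` (`τ(Γ_g(q)) = Γ_g(q)`),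
  `discreteTopology_map_siegelPrincipalGamma`, **`exists_quotientMap_negConj_siegelPrincipalGamma`**
  (`Γ = Γ_g(q) = ι(Γⁿ(q))`, every `q`: `X(q)_ℝ = Γ(q)∖S` with `S` the set of `Γ(q)`-real points, Theorem 8's
  first sentence).

## References

* [GoreskyTai2003RealModuli] M. Goresky, Y. S. Tai, Compositio Math. 139 (2003) 1–27, §2.3, §4.2, Thm. 8.
* [Yang2015PolarizedRealTori] J.-H. Yang, J. Korean Math. Soc. 52 (2015), §2 (2.3)–(2.6).
* [Lange2023AbelianVarietiesComplex] H. Lange (2023), §3.1.3 Prop. 3.1.9, §3.1.4 Thm. 3.1.11, §3.2.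
* [Silhol1989] R. Silhol, *Real Algebraic Surfaces*, LNM 1392 (1989), Ch. IV §4.
-/

noncomputable section

open scoped Manifold Matrix ComplexConjugate Topology
open Matrix Function

namespace Literature.AlgebraicGeometry.ModuliOfAbelianVarieties

namespace SiegelModuli

open Literature.NumberTheory.Automorphic (siegelUpperHalfSpace)
open Literature.NumberTheory.ModularForms.SiegelUpperHalfSpace (symplecticIntHom siegelModularGroup
  symplecticIntHom_injective t2Space_quotient discreteTopology_of_forall_exists_int exists_int_eq_of_mem_siegelModularGroup)
open Literature.NumberTheory.ModularForms.SiegelModularForm (siegelPrincipalGamma)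

variable {g : ℕ}

/-! ## §1 `τ² = id`, and the observation `π(τΩ) = π(Ω) ⟺ ∃ γ ∈ Γ, γ • Ω = τΩ` -/

/-- **`τ(τΩ) = Ω`** on `𝔥_g`. [cite: GoreskyTai2003RealModuli, §2.3 («anti-holomorphic involution»)] [cite: Yang2015PolarizedRealTori, §2 (2.4)] -/
theorem negConj_negConj_siegelUpperHalfSpace (Ω : siegelUpperHalfSpace g) :
    (⟨-((⟨-(Ω : Matrix (Fin g) (Fin g) ℂ).map conj, neg_map_conj_mem_siegelUpperHalfSpace Ω.2⟩ : siegelUpperHalfSpace g) :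
          Matrix (Fin g) (Fin g) ℂ).map conj,
        neg_map_conj_mem_siegelUpperHalfSpace
          (⟨-(Ω : Matrix (Fin g) (Fin g) ℂ).map conj, neg_map_conj_mem_siegelUpperHalfSpace Ω.2⟩ : siegelUpperHalfSpace g).2⟩ :
      siegelUpperHalfSpace g) = Ω :=
  Subtype.ext (neg_map_conj_neg_map_conj (Ω : Matrix (Fin g) (Fin g) ℂ))

/-- **THE OBSERVATION** («the image `[Z] ∈ X` of a point `Z ∈ 𝔥_n` lies in `X_ℝ` iff there exists `γ ∈ Γ` such that
`γZ = −Z̄`»): in `X = Γ∖𝔥_g`, `[τΩ] = [Ω]` iff some `γ ∈ Γ` carries `Ω` to `τΩ` — for EVERY subgroup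
`Γ ⊂ Sp_{2g}(ℝ)`. [cite: GoreskyTai2003RealModuli, §4.2] [cite: Yang2015PolarizedRealTori, §2 (2.5)–(2.6)] -/
theorem quotientMk_negConj_eq_quotientMk_iff (Γ : Subgroup (Matrix.symplecticGroup (Fin g) ℝ))
    (Ω : siegelUpperHalfSpace g) :
    Quotient.mk (MulAction.orbitRel Γ (siegelUpperHalfSpace g))
        (⟨-(Ω : Matrix (Fin g) (Fin g) ℂ).map conj, neg_map_conj_mem_siegelUpperHalfSpace Ω.2⟩ : siegelUpperHalfSpace g) =
      Quotient.mk (MulAction.orbitRel Γ (siegelUpperHalfSpace g)) Ω ↔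
      ∃ γ ∈ Γ, γ • Ω = ⟨-(Ω : Matrix (Fin g) (Fin g) ℂ).map conj, neg_map_conj_mem_siegelUpperHalfSpace Ω.2⟩ := by
  rw [Quotient.eq]
  change (⟨-(Ω : Matrix (Fin g) (Fin g) ℂ).map conj, neg_map_conj_mem_siegelUpperHalfSpace Ω.2⟩ : siegelUpperHalfSpace g) ∈
      MulAction.orbit Γ Ω ↔ _
  rw [MulAction.mem_orbit_iff]
  exact ⟨fun ⟨γ, hγ⟩ ↦ ⟨γ, γ.2, hγ⟩, fun ⟨γ, hγ, h⟩ ↦ ⟨⟨γ, hγ⟩, h⟩⟩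

/-! ## §2 `τ` descends to `X = Γ∖𝔥_g` for every `τ`-stable `Γ` -/

/-- **`τ` PASSES TO AN INVOLUTION ON `X = Γ∖𝔥_g`** for every subgroup `Γ ⊂ Sp_{2g}(ℝ)` with `τ(Γ) ⊂ Γ`: there
is a continuous involution `τ_X` of the orbit space with `τ_X[Ω] = [τΩ]` (well defined because
`τ(γ • Ω) = τ(γ) • τΩ`), whose fixed points are exactly the classes of the `Γ`-real points:
`τ_X[Ω] = [Ω] ⟺ ∃ γ ∈ Γ, γ • Ω = τΩ`, i.e. `π⁻¹(X_ℝ) = S = ⋃_{γ ∈ Γ} ℍ_g^{τγ}`.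
[cite: GoreskyTai2003RealModuli, §2.3 («`τ` passes to an anti-holomorphic involution on `X`») and §4.2] [cite: Yang2015PolarizedRealTori, §2 (2.3), (2.6)] -/
theorem exists_continuous_involutive_quotientMap_negConj {Γ : Subgroup (Matrix.symplecticGroup (Fin g) ℝ)}
    (hΓ : ∀ x ∈ Γ, (⟨Matrix.fromBlocks (-1 : Matrix (Fin g) (Fin g) ℝ) 0 0 (1 : Matrix (Fin g) (Fin g) ℝ) *
        (x : Matrix (Fin g ⊕ Fin g) (Fin g ⊕ Fin g) ℝ) *
        Matrix.fromBlocks (-1 : Matrix (Fin g) (Fin g) ℝ) 0 0 (1 : Matrix (Fin g) (Fin g) ℝ),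
      iStar_mul_mul_iStar_mem_symplecticGroup x.2⟩ : Matrix.symplecticGroup (Fin g) ℝ) ∈ Γ) :
    ∃ τX : Quotient (MulAction.orbitRel Γ (siegelUpperHalfSpace g)) →
        Quotient (MulAction.orbitRel Γ (siegelUpperHalfSpace g)),
      Continuous τX ∧ Function.Involutive τX ∧
      (∀ Ω : siegelUpperHalfSpace g,
        τX (Quotient.mk (MulAction.orbitRel Γ (siegelUpperHalfSpace g)) Ω) =
          Quotient.mk (MulAction.orbitRel Γ (siegelUpperHalfSpace g))
            ⟨-(Ω : Matrix (Fin g) (Fin g) ℂ).map conj, neg_map_conj_mem_siegelUpperHalfSpace Ω.2⟩) ∧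
      (∀ Ω : siegelUpperHalfSpace g,
        τX (Quotient.mk (MulAction.orbitRel Γ (siegelUpperHalfSpace g)) Ω) =
            Quotient.mk (MulAction.orbitRel Γ (siegelUpperHalfSpace g)) Ω ↔
          ∃ γ ∈ Γ, γ • Ω = ⟨-(Ω : Matrix (Fin g) (Fin g) ℂ).map conj, neg_map_conj_mem_siegelUpperHalfSpace Ω.2⟩) ∧
      Quotient.mk (MulAction.orbitRel Γ (siegelUpperHalfSpace g)) ⁻¹' {x | τX x = x} =
        {Ω : siegelUpperHalfSpace g | ∃ γ ∈ Γ,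
          γ • Ω = ⟨-(Ω : Matrix (Fin g) (Fin g) ℂ).map conj, neg_map_conj_mem_siegelUpperHalfSpace Ω.2⟩} := by
  -- `τ` respects `Γ`-orbits: `τ(γ • Ω) = τ(γ) • τΩ` with `τ(γ) ∈ Γ`
  have compat : ∀ a b : siegelUpperHalfSpace g, (MulAction.orbitRel Γ (siegelUpperHalfSpace g)) a b →
      (MulAction.orbitRel Γ (siegelUpperHalfSpace g))
        (⟨-(a : Matrix (Fin g) (Fin g) ℂ).map conj, neg_map_conj_mem_siegelUpperHalfSpace a.2⟩ : siegelUpperHalfSpace g)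
        (⟨-(b : Matrix (Fin g) (Fin g) ℂ).map conj, neg_map_conj_mem_siegelUpperHalfSpace b.2⟩ : siegelUpperHalfSpace g) := by
    intro a b hab
    change a ∈ MulAction.orbit Γ b at hab
    change (⟨-(a : Matrix (Fin g) (Fin g) ℂ).map conj, neg_map_conj_mem_siegelUpperHalfSpace a.2⟩ : siegelUpperHalfSpace g) ∈
      MulAction.orbit Γ (⟨-(b : Matrix (Fin g) (Fin g) ℂ).map conj, neg_map_conj_mem_siegelUpperHalfSpace b.2⟩ :
        siegelUpperHalfSpace g)
    obtain ⟨γ, rfl⟩ := MulAction.mem_orbit_iff.1 hab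
    exact MulAction.mem_orbit_iff.2 ⟨⟨_, hΓ _ γ.2⟩, iStar_smul_negConj (γ : Matrix.symplecticGroup (Fin g) ℝ) b⟩
  refine ⟨Quotient.map' _ compat, continuous_negConj.quotient_map' compat, fun x ↦ ?_, fun Ω ↦ rfl, fun Ω ↦ ?_, ?_⟩
  · obtain ⟨Ω, rfl⟩ := Quotient.exists_rep x
    exact congrArg (Quotient.mk (MulAction.orbitRel Γ (siegelUpperHalfSpace g))) (negConj_negConj_siegelUpperHalfSpace Ω)
  · exact quotientMk_negConj_eq_quotientMk_iff Γ Ω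
  · exact Set.ext fun Ω ↦ quotientMk_negConj_eq_quotientMk_iff Γ Ω

/-- For a DISCRETE `Γ` the quotient `X = Γ∖𝔥_g` is Hausdorff (Thm. 3.1.11), so the fixed set of any
continuous self-map of `X` — in particular the set `X_ℝ` of real points of `τ_X` — is closed.
[cite: Lange2023AbelianVarietiesComplex, §3.1.4 Thm. 3.1.11, p. 162] [cite: GoreskyTai2003RealModuli, §2.3 («the set of real points»)] -/
theorem isClosed_setOf_apply_eq_self_of_discrete (Γ : Subgroup (Matrix.symplecticGroup (Fin g) ℝ)) [DiscreteTopology Γ]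
    {τX : Quotient (MulAction.orbitRel Γ (siegelUpperHalfSpace g)) → Quotient (MulAction.orbitRel Γ (siegelUpperHalfSpace g))}
    (hτ : Continuous τX) : IsClosed {x | τX x = x} := by
  haveI := t2Space_quotient (g := g) Γ
  exact isClosed_eq hτ continuous_id

/-! ## §3 The two cases of the sources: `Γ_g = Sp_{2g}(ℤ)` and the principal congruence subgroups `Γ_g(q)` -/

/-- **`τ_X` ON `𝔄_g = Γ_g∖𝔥_g`**: a continuous involution with `τ_X[Ω] = [−Ω̄]`, real points
`X_ℝ = {[Ω] : ∃ γ ∈ Γ_g, γ • Ω = −Ω̄}` — a CLOSED subset with `π⁻¹(X_ℝ) = ℍ_g^{τΓ_g}` (closed in `𝔥_g`, g51-#7).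
[cite: GoreskyTai2003RealModuli, §2.3 and §4.2] [cite: Yang2015PolarizedRealTori, §2 (2.6)] [cite: Lange2023AbelianVarietiesComplex, §3.1.4 Thm. 3.1.11–3.1.12] -/
theorem exists_quotientMap_negConj_siegelModularGroup :
    ∃ τX : Quotient (MulAction.orbitRel (siegelModularGroup g) (siegelUpperHalfSpace g)) →
        Quotient (MulAction.orbitRel (siegelModularGroup g) (siegelUpperHalfSpace g)),
      Continuous τX ∧ Function.Involutive τX ∧
      (∀ Ω : siegelUpperHalfSpace g,
        τX (Quotient.mk (MulAction.orbitRel (siegelModularGroup g) (siegelUpperHalfSpace g)) Ω) =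
          Quotient.mk (MulAction.orbitRel (siegelModularGroup g) (siegelUpperHalfSpace g))
            ⟨-(Ω : Matrix (Fin g) (Fin g) ℂ).map conj, neg_map_conj_mem_siegelUpperHalfSpace Ω.2⟩) ∧
      (∀ Ω : siegelUpperHalfSpace g,
        τX (Quotient.mk (MulAction.orbitRel (siegelModularGroup g) (siegelUpperHalfSpace g)) Ω) =
            Quotient.mk (MulAction.orbitRel (siegelModularGroup g) (siegelUpperHalfSpace g)) Ω ↔
          ∃ γ ∈ siegelModularGroup g,
            γ • Ω = ⟨-(Ω : Matrix (Fin g) (Fin g) ℂ).map conj, neg_map_conj_mem_siegelUpperHalfSpace Ω.2⟩) ∧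
      Quotient.mk (MulAction.orbitRel (siegelModularGroup g) (siegelUpperHalfSpace g)) ⁻¹' {x | τX x = x} =
        {Ω : siegelUpperHalfSpace g | ∃ γ ∈ siegelModularGroup g,
          γ • Ω = ⟨-(Ω : Matrix (Fin g) (Fin g) ℂ).map conj, neg_map_conj_mem_siegelUpperHalfSpace Ω.2⟩} ∧
      IsClosed {x | τX x = x} := by
  obtain ⟨τX, hc, hi, hπ, hfix, hpre⟩ := exists_continuous_involutive_quotientMap_negConj (g := g)
    (Γ := siegelModularGroup g) fun x hx ↦ iStar_mul_mul_iStar_mem_siegelModularGroup hx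
  exact ⟨τX, hc, hi, hπ, hfix, hpre, isClosed_setOf_apply_eq_self_of_discrete _ hc⟩

/-- Membership in `Γ_g(q) = ι(Γⁿ(q)) ⊂ Sp_{2g}(ℝ)`. [cite: GoreskyTai2003RealModuli, §4.1 («`Γ(N) = {γ ∈ Γ(1) | γ ≡ I (mod N)}`»)] -/
theorem mem_map_siegelPrincipalGamma_iff {q : ℕ} {x : Matrix.symplecticGroup (Fin g) ℝ} :
    x ∈ (siegelPrincipalGamma g q).map (symplecticIntHom g) ↔
      ∃ γ ∈ siegelPrincipalGamma g q, symplecticIntHom g γ = x :=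
  Subgroup.mem_map

/-- **`τ(Γ_g(q)) = Γ_g(q)`**: the image of `Γⁿ(q)` in `Sp_{2g}(ℝ)` is `τ`-stable (`τ(ι γ) = ι(KγK)`, g51-#4/#5), so
`τ` descends to `X(q) = Γ_g(q)∖𝔥_g`. [cite: GoreskyTai2003RealModuli, §4.2 («passes to an anti-holomorphic involution on `X = Γ(N)∖𝔥_n`»)] -/
theorem iStarConj_mem_map_siegelPrincipalGamma {q : ℕ} {x : Matrix.symplecticGroup (Fin g) ℝ}
    (hx : x ∈ (siegelPrincipalGamma g q).map (symplecticIntHom g)) :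
    (⟨Matrix.fromBlocks (-1 : Matrix (Fin g) (Fin g) ℝ) 0 0 (1 : Matrix (Fin g) (Fin g) ℝ) *
          (x : Matrix (Fin g ⊕ Fin g) (Fin g ⊕ Fin g) ℝ) *
          Matrix.fromBlocks (-1 : Matrix (Fin g) (Fin g) ℝ) 0 0 (1 : Matrix (Fin g) (Fin g) ℝ),
        iStar_mul_mul_iStar_mem_symplecticGroup x.2⟩ : Matrix.symplecticGroup (Fin g) ℝ) ∈
      (siegelPrincipalGamma g q).map (symplecticIntHom g) := by
  obtain ⟨γ, hγ, rfl⟩ := Subgroup.mem_map.1 hx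
  exact Subgroup.mem_map.2 ⟨_, conjK_mul_mul_conjK_mem_siegelPrincipalGamma hγ, symplecticIntHom_conjK γ⟩

/-- **`Γ_g(q)` is a discrete subgroup of `Sp_{2g}(ℝ)`** (integer entries). [cite: Lange2023AbelianVarietiesComplex, §3.1.3 Prop. 3.1.9 and §3.2 («the group `Γ_D(n)` acts properly and discontinuously»)] -/
theorem discreteTopology_map_siegelPrincipalGamma (q : ℕ) :
    DiscreteTopology ((siegelPrincipalGamma g q).map (symplecticIntHom g)) :=
  discreteTopology_of_forall_exists_int (L := 1) one_pos fun M hM i j ↦ by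
    obtain ⟨z, hz⟩ := exists_int_eq_of_mem_siegelModularGroup (Subgroup.map_le_range _ _ hM) i j
    exact ⟨z, by rw [hz, Nat.cast_one, mul_one]⟩

/-- **`τ_X` ON `X(q) = Γ_g(q)∖𝔥_g`, EVERY LEVEL `q`** («Let `X = Γ(N)∖𝔥_n` … The involution `τ(Z) = −Z̄` passes to
an anti-holomorphic involution on `X`»; «The set `X_ℝ` of real points of `X` is precisely `Γ(4m)∖S`», first
sentence of Theorem 8, for every `q`): a continuous involution with `τ_X[Ω] = [−Ω̄]`, fixed exactly at the classes
of `Γ(q)`-real points, `X_ℝ` closed, `π⁻¹(X_ℝ) = S` (closed in `𝔥_g` by g51-#7; a disjoint locally finite union of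
slices for `q ≥ 3`). [cite: GoreskyTai2003RealModuli, §4.2 and Thm. 8] [cite: Lange2023AbelianVarietiesComplex, §3.2 Thm. 3.2.1–3.2.2] -/
theorem exists_quotientMap_negConj_siegelPrincipalGamma (q : ℕ) :
    ∃ τX : Quotient (MulAction.orbitRel ((siegelPrincipalGamma g q).map (symplecticIntHom g)) (siegelUpperHalfSpace g)) →
        Quotient (MulAction.orbitRel ((siegelPrincipalGamma g q).map (symplecticIntHom g)) (siegelUpperHalfSpace g)),
      Continuous τX ∧ Function.Involutive τX ∧
      (∀ Ω : siegelUpperHalfSpace g,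
        τX (Quotient.mk (MulAction.orbitRel ((siegelPrincipalGamma g q).map (symplecticIntHom g))
            (siegelUpperHalfSpace g)) Ω) =
          Quotient.mk (MulAction.orbitRel ((siegelPrincipalGamma g q).map (symplecticIntHom g)) (siegelUpperHalfSpace g))
            ⟨-(Ω : Matrix (Fin g) (Fin g) ℂ).map conj, neg_map_conj_mem_siegelUpperHalfSpace Ω.2⟩) ∧
      (∀ Ω : siegelUpperHalfSpace g,
        τX (Quotient.mk (MulAction.orbitRel ((siegelPrincipalGamma g q).map (symplecticIntHom g))
              (siegelUpperHalfSpace g)) Ω) =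
            Quotient.mk (MulAction.orbitRel ((siegelPrincipalGamma g q).map (symplecticIntHom g))
              (siegelUpperHalfSpace g)) Ω ↔
          ∃ γ ∈ siegelPrincipalGamma g q,
            symplecticIntHom g γ • Ω = ⟨-(Ω : Matrix (Fin g) (Fin g) ℂ).map conj, neg_map_conj_mem_siegelUpperHalfSpace Ω.2⟩) ∧
      Quotient.mk (MulAction.orbitRel ((siegelPrincipalGamma g q).map (symplecticIntHom g)) (siegelUpperHalfSpace g)) ⁻¹'
          {x | τX x = x} =
        {Ω : siegelUpperHalfSpace g | ∃ γ ∈ siegelPrincipalGamma g q,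
          symplecticIntHom g γ • Ω = ⟨-(Ω : Matrix (Fin g) (Fin g) ℂ).map conj, neg_map_conj_mem_siegelUpperHalfSpace Ω.2⟩} ∧
      IsClosed {x | τX x = x} := by
  haveI := discreteTopology_map_siegelPrincipalGamma (g := g) q
  obtain ⟨τX, hc, hi, hπ, hfix, hpre⟩ := exists_continuous_involutive_quotientMap_negConj (g := g)
    (Γ := (siegelPrincipalGamma g q).map (symplecticIntHom g)) fun x hx ↦ iStarConj_mem_map_siegelPrincipalGamma hx
  -- `∃ x ∈ ι(Γ(q)), x • Ω = τΩ` ⟺ `∃ γ ∈ Γ(q), ι γ • Ω = τΩ`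
  have hex : ∀ Ω : siegelUpperHalfSpace g,
      (∃ x ∈ (siegelPrincipalGamma g q).map (symplecticIntHom g),
          x • Ω = ⟨-(Ω : Matrix (Fin g) (Fin g) ℂ).map conj, neg_map_conj_mem_siegelUpperHalfSpace Ω.2⟩) ↔
        ∃ γ ∈ siegelPrincipalGamma g q,
          symplecticIntHom g γ • Ω = ⟨-(Ω : Matrix (Fin g) (Fin g) ℂ).map conj, neg_map_conj_mem_siegelUpperHalfSpace Ω.2⟩ :=
    fun Ω ↦ ⟨fun ⟨x, hx, h⟩ ↦ by
        obtain ⟨γ, hγ, rfl⟩ := Subgroup.mem_map.1 hx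
        exact ⟨γ, hγ, h⟩,
      fun ⟨γ, hγ, h⟩ ↦ ⟨symplecticIntHom g γ, Subgroup.mem_map.2 ⟨γ, hγ, rfl⟩, h⟩⟩
  refine ⟨τX, hc, hi, hπ, fun Ω ↦ (hfix Ω).trans (hex Ω), ?_, isClosed_setOf_apply_eq_self_of_discrete _ hc⟩
  rw [hpre]
  exact Set.ext fun Ω ↦ hex Ω

end SiegelModuli

end Literature.AlgebraicGeometry.ModuliOfAbelianVarieties
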